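import Summits.CriticalPhenomena.CardyFormulaZ2.Theorems.CardyIKTransportCornerLineDescentLine
import Summits.CriticalPhenomena.CardyFormulaZ2.Theorems.CardyIKTransportCornerLineDescentSyndromeBiasFinite
import Summits.CriticalPhenomena.CardyFormulaZ2.Theorems.CardyIKTransportCornerLineDescentSyndromeBiasGauge
import Literature.Probability.Percolation.RussoFormula

/-!
# Stub `stub_SyndromeBias` of line `symmetric-seed-second-order`, crux `CardyIKTransport.CornerLineDescent`
# (stmt-CriticalPhenomena-10964) — part 5/5: cylinder formula and assembly

`theorem stub_SyndromeBias : ∀ p, 0 < p → p < 1 → ∃ C, SyndromeBiasAt p C`: under the corner-line gauge with syndrome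
density `p`, the conditional bias of one syndrome bit `κ_f` given the colours on the ring of radius `r ≥ 1` around the
face `f` is at most `C(p) |1-2p|^{2r}` times the probability of the ring colouring.

PROOF.  (1) `gauge_real_eq_tripleSum` (three applications of `peel`, Mathlib's `setBernoulli` cylinder
probabilities via `Russo.setBernoulli_real_localCylinder`): both probabilities are finite sums over bit patterns of
product weights.  (2) Part 4 (`tripleSum_shear`): the shear `(A,B) ↦ (A ∆ T_A(D), B ∆ T_B(D))` replaces the ring
cylinder by the block ring cylinder, which reads only the `(2r+1)²` inner syndromes; its sections at fixed column/row
patterns read them only through full-row and full-column parities (`blockEvent_saturated`).  (3) Part 3 (`sat_bias`,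
characters of the row/column code): each section obeys the bias bound with the same `K(p)`; summing the sections
(`abs_bias_sum_le`) gives the stub with `C = K(p)`.
-/

noncomputable section

namespace Summit.CriticalPhenomena.CardyFormulaZ2.Theorems.CornerLineDescent.SymmetricSeed

open scoped BigOperators Topology Classical MeasureTheory ProbabilityTheory ENNReal NNReal
open Filter Set Function MeasureTheory
open Literature.Probability.Percolation (sitePercolation bondPercolation half BondConfig embDomainCrossing rectangle)
open Literature.Probability.LatticeModels
open Literature.Probability.RandomPlanarGeometry

namespace SyndromeBias

open Finset

open Literature.Probability.Percolation in
/-- Peeling one Bernoulli factor off a product measure: an event on `Set ι × β` that reads only the coordinates in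
the finite set `K` of the first factor is the disjoint union of the `K`-cylinders times its sections, so it is
measurable and its probability is the cylinder-weighted sum of the section probabilities (finite-dimensional
marginal of `setBer(univ, q)`). [folklore] -/
theorem peel {ι β : Type*} [MeasurableSpace β] (q : unitInterval) (ν : Measure β)
    [IsProbabilityMeasure ν] (K : Finset ι) (E : Set (Set ι × β))
    (hE : ∀ (S S' : Set ι) (y : β), S ∩ ↑K = S' ∩ ↑K → ((S, y) ∈ E ↔ (S', y) ∈ E))
    (hm : ∀ S : Finset ι, MeasurableSet {y | ((↑S : Set ι), y) ∈ E}) :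
    MeasurableSet E ∧ ((sitePercolation ι q).prod ν).real E =
      ∑ S ∈ K.powerset, ((q : ℝ) ^ S.card * (1 - q) ^ (K.card - S.card)) *
        ν.real {y | ((↑S : Set ι), y) ∈ E} := by
  have hdec : E = ⋃ S ∈ K.powerset,
      (localCylinder (↑K : Set ι) (↑S : Set ι)) ×ˢ {y | ((↑S : Set ι), y) ∈ E} := by
    ext ⟨T, y⟩
    simp only [Set.mem_iUnion, Set.mem_prod, Set.mem_setOf_eq, exists_prop]
    constructor
    · intro h
      refine ⟨K.filter (· ∈ T), Finset.mem_powerset.2 (Finset.filter_subset _ _), ?_, ?_⟩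
      · intro i hi
        simp [Finset.mem_coe.1 hi]
      · refine (hE T _ y ?_).1 h
        ext i
        simp only [Set.mem_inter_iff, Finset.mem_coe, Finset.coe_filter, Set.mem_setOf_eq]
        tauto
    · rintro ⟨S, -, hT, hSy⟩
      refine (hE T ↑S y ?_).2 hSy
      ext i
      simp only [Set.mem_inter_iff, Finset.mem_coe]
      constructor
      · rintro ⟨hiT, hiK⟩; exact ⟨(hT i (Finset.mem_coe.2 hiK)).1 hiT, hiK⟩
      · rintro ⟨hiS, hiK⟩; exact ⟨(hT i (Finset.mem_coe.2 hiK)).2 hiS, hiK⟩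
  have hpiece : ∀ S ∈ K.powerset, MeasurableSet
      ((localCylinder (↑K : Set ι) (↑S : Set ι)) ×ˢ {y | ((↑S : Set ι), y) ∈ E}) :=
    fun S _ => (measurableSet_localCylinder K.countable_toSet _).prod (hm S)
  have hmeas : MeasurableSet E := by
    rw [hdec]; exact Finset.measurableSet_biUnion _ hpiece
  refine ⟨hmeas, ?_⟩
  conv_lhs => rw [hdec]
  rw [measureReal_biUnion_finset _ hpiece]
  · refine Finset.sum_congr rfl fun S hS => ?_
    have hSK : S ⊆ K := Finset.mem_powerset.1 hS
    rw [measureReal_prod_prod, sitePercolation, Russo.setBernoulli_real_localCylinder]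
    congr 1
    have hw : ∀ i ∈ K, Russo.weight (Set.univ : Set ι) (↑S : Set ι) i (q : ℝ) =
        if i ∈ S then (q : ℝ) else 1 - q := by
      intro i _
      simp [Russo.weight]
    rw [Finset.prod_congr rfl hw, Finset.prod_ite, Finset.prod_const, Finset.prod_const]
    have h1 : K.filter (fun i => i ∈ S) = S := by
      ext i; simp only [Finset.mem_filter]; exact ⟨fun h => h.2, fun h => ⟨hSK h, h⟩⟩
    have h2 : K.filter (fun i => ¬ i ∈ S) = K \ S := by
      ext i; simp [Finset.mem_sdiff]
    rw [h1, h2, Finset.card_sdiff_of_subset hSK]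
  · intro S hS T hT hST
    exact (Russo.disjoint_localCylinder (Finset.mem_powerset.1 hS) (Finset.mem_powerset.1 hT)
      hST).set_prod_left _ _

/-- At density `½` every pattern on `K` has weight `2^{-#K}`. [folklore] -/
theorem half_weight (K S : Finset ℤ) (hS : S ⊆ K) :
    ((half : unitInterval) : ℝ) ^ S.card * (1 - (half : unitInterval)) ^ (K.card - S.card) =
      (1 / 2 : ℝ) ^ K.card := by
  rw [Literature.Probability.Percolation.coe_half, show (1 : ℝ) - 1 / 2 = 1 / 2 by norm_num,
    ← pow_add, Nat.add_sub_cancel' (Finset.card_le_card hS)]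

/-- Cylinder formula for the product gauge: the probability of an event determined by finitely many column bits, row
bits and syndromes is its `tripleSum` (three applications of `peel`; the auxiliary fair fields integrate to `1`).
[folklore] -/
theorem gauge_real_eq_tripleSum (p : ℝ) (KA KB : Finset ℤ) (KD : Finset (Site 2)) (E : Set Bits)
    (hE : E ∈ DetBy KA KB KD) : (gaugeMeasure p).real E = tripleSum p KA KB KD E := by
  set q : unitInterval := Set.projIcc (0:ℝ) 1 zero_le_one p with hq
  set ν₃ : Measure (Set (Site 2) × Set (Site 2)) :=
    (sitePercolation (Site 2) half).prod (sitePercolation (Site 2) half) with hν₃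
  set ν₂ : Measure (Set (Site 2) × (Set (Site 2) × Set (Site 2))) :=
    (sitePercolation (Site 2) q).prod ν₃ with hν₂
  set ν₁ : Measure (Set ℤ × (Set (Site 2) × (Set (Site 2) × Set (Site 2)))) :=
    (sitePercolation ℤ half).prod ν₂ with hν₁
  have hμ : gaugeMeasure p = (sitePercolation ℤ half).prod ν₁ := rfl
  -- level 3
  have L3 : ∀ SA SB : Finset ℤ,
      MeasurableSet {z : Set (Site 2) × (Set (Site 2) × Set (Site 2)) |
        (((↑SA : Set ℤ), ((↑SB : Set ℤ), z)) : Bits) ∈ E} ∧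
      ν₂.real {z : Set (Site 2) × (Set (Site 2) × Set (Site 2)) |
        (((↑SA : Set ℤ), ((↑SB : Set ℤ), z)) : Bits) ∈ E} =
        ∑ SD ∈ KD.powerset, ((q : ℝ) ^ SD.card * (1 - q) ^ (KD.card - SD.card)) *
          (if (((↑SA : Set ℤ), ((↑SB : Set ℤ), ((↑SD : Set (Site 2)),
            ((∅ : Set (Site 2)), (∅ : Set (Site 2)))))) : Bits) ∈ E then 1 else 0) := by
    intro SA SB
    set E₃ := {z : Set (Site 2) × (Set (Site 2) × Set (Site 2)) |
        (((↑SA : Set ℤ), ((↑SB : Set ℤ), z)) : Bits) ∈ E} with hE₃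
    have hE₃' : ∀ (S S' : Set (Site 2)) (u : Set (Site 2) × Set (Site 2)),
        S ∩ ↑KD = S' ∩ ↑KD → ((S, u) ∈ E₃ ↔ (S', u) ∈ E₃) :=
      fun S S' u h => hE (↑SA, ↑SB, S, u) (↑SA, ↑SB, S', u) rfl rfl h
    have hsec : ∀ SD : Finset (Site 2), {u : Set (Site 2) × Set (Site 2) | ((↑SD : Set (Site 2)), u) ∈ E₃} =
        if (((↑SA : Set ℤ), ((↑SB : Set ℤ), ((↑SD : Set (Site 2)),
            ((∅ : Set (Site 2)), (∅ : Set (Site 2)))))) : Bits) ∈ E then Set.univ else ∅ := by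
      intro SD
      ext u
      have key := hE (↑SA, ↑SB, ↑SD, u) (↑SA, ↑SB, ↑SD, (∅, ∅)) rfl rfl rfl
      simp only [hE₃, Set.mem_setOf_eq]
      split_ifs with h
      · simp only [Set.mem_univ, iff_true]; exact key.2 h
      · simp only [Set.mem_empty_iff_false, iff_false]; exact fun h' => h (key.1 h')
    have hm : ∀ SD : Finset (Site 2),
        MeasurableSet {u : Set (Site 2) × Set (Site 2) | ((↑SD : Set (Site 2)), u) ∈ E₃} := by
      intro SD; rw [hsec]; split_ifs; exacts [MeasurableSet.univ, MeasurableSet.empty]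
    obtain ⟨hmeas, hreal⟩ := peel q ν₃ KD E₃ hE₃' hm
    refine ⟨hmeas, ?_⟩
    rw [hreal]
    refine Finset.sum_congr rfl fun SD _ => ?_
    rw [hsec]
    split_ifs <;> simp
  -- level 2
  have L2 : ∀ SA : Finset ℤ,
      MeasurableSet {y : Set ℤ × (Set (Site 2) × (Set (Site 2) × Set (Site 2))) |
        (((↑SA : Set ℤ), y) : Bits) ∈ E} ∧
      ν₁.real {y : Set ℤ × (Set (Site 2) × (Set (Site 2) × Set (Site 2))) |
        (((↑SA : Set ℤ), y) : Bits) ∈ E} =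
        ∑ SB ∈ KB.powerset, (1 / 2 : ℝ) ^ KB.card *
          ∑ SD ∈ KD.powerset, ((q : ℝ) ^ SD.card * (1 - q) ^ (KD.card - SD.card)) *
            (if (((↑SA : Set ℤ), ((↑SB : Set ℤ), ((↑SD : Set (Site 2)),
              ((∅ : Set (Site 2)), (∅ : Set (Site 2)))))) : Bits) ∈ E then 1 else 0) := by
    intro SA
    set E₂ := {y : Set ℤ × (Set (Site 2) × (Set (Site 2) × Set (Site 2))) |
        (((↑SA : Set ℤ), y) : Bits) ∈ E} with hE₂
    have hE₂' : ∀ (S S' : Set ℤ) (z : Set (Site 2) × (Set (Site 2) × Set (Site 2))),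
        S ∩ ↑KB = S' ∩ ↑KB → ((S, z) ∈ E₂ ↔ (S', z) ∈ E₂) :=
      fun S S' z h => hE (↑SA, S, z) (↑SA, S', z) rfl h rfl
    obtain ⟨hmeas, hreal⟩ := peel half ν₂ KB E₂ hE₂' (fun SB => (L3 SA SB).1)
    refine ⟨hmeas, ?_⟩
    rw [hreal]
    refine Finset.sum_congr rfl fun SB hSB => ?_
    rw [half_weight KB SB (Finset.mem_powerset.1 hSB)]
    congr 1
    exact (L3 SA SB).2
  -- level 1
  have hE₁ : ∀ (S S' : Set ℤ) (y : Set ℤ × (Set (Site 2) × (Set (Site 2) × Set (Site 2)))),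
      S ∩ ↑KA = S' ∩ ↑KA → ((S, y) ∈ E ↔ (S', y) ∈ E) :=
    fun S S' y h => hE (S, y) (S', y) h rfl rfl
  obtain ⟨-, hreal⟩ := peel half ν₁ KA E hE₁ (fun SA => (L2 SA).1)
  rw [hμ, hreal]
  unfold tripleSum
  refine Finset.sum_congr rfl fun SA hSA => ?_
  rw [half_weight KA SA (Finset.mem_powerset.1 hSA), (L2 SA).2, Finset.mul_sum]
  refine Finset.sum_congr rfl fun SB _ => ?_
  rw [Finset.mul_sum, Finset.mul_sum]
  refine Finset.sum_congr rfl fun SD _ => ?_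
  simp only [qOf, ← hq]
  split_ifs <;> ring

/-- Box parities of an imaged pattern are `ZMod 2` double sums of its indicator. [folklore] -/
theorem boxZ_image (X : Finset (ℤ × ℤ)) (A B : Finset ℤ) :
    boxZ (↑(X.image toSite) : Set (Site 2)) A B =
      ∑ i ∈ A, ∑ j ∈ B, (if (i, j) ∈ X then (1 : ZMod 2) else 0) := by
  unfold boxZ
  refine Finset.sum_congr rfl fun i _ => Finset.sum_congr rfl fun j _ => ?_
  rw [bz_congr (show toSite (i, j) ∈ (↑(X.image toSite) : Set (Site 2)) ↔ (i, j) ∈ X by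
    rw [Finset.mem_coe, toSite.injective.mem_finset_image])]
  unfold bz
  congr

/-- `2r+1` inner columns. [folklore] -/
theorem card_Rc (f : Site 2) (r : ℕ) : #(Rc f r) = 2 * r + 1 := by
  unfold Rc; rw [Int.card_Ico]; omega

/-- `2r+1` inner rows. [folklore] -/
theorem card_Cr (f : Site 2) (r : ℕ) : #(Cr f r) = 2 * r + 1 := by
  unfold Cr; rw [Int.card_Ico]; omega

/-- `f` is an inner syndrome (the centre). [folklore] -/
theorem fpair_mem_In (f : Site 2) (r : ℕ) : (f 0, f 1) ∈ Rc f r ×ˢ Cr f r := by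
  unfold Rc Cr; simp only [Finset.mem_product, Finset.mem_Ico]; omega

/-- `projIcc` does not clamp `p ∈ [0,1]`. [folklore] -/
theorem qOf_eq {p : ℝ} (hp0 : 0 ≤ p) (hp1 : p ≤ 1) : qOf p = p := by
  unfold qOf; rw [Set.projIcc_of_mem _ ⟨hp0, hp1⟩]

/-- WHAT THE RING REVEALS: the block colour of a ring cell reads the inner syndromes only through full-column
parities (top row: prefix sums) and full-row parities (right column; bottom row and left column read nothing), so
each `(S_A, S_B)`-section of the block ring cylinder is parity-saturated. [folklore] -/
theorem blockEvent_saturated (f : Site 2) (r : ℕ) (η : Site 2 → Prop) (SA SB : Finset ℤ)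
    (X Y : Finset (ℤ × ℤ)) (_hX : X ⊆ Rc f r ×ˢ Cr f r) (_hY : Y ⊆ Rc f r ×ˢ Cr f r)
    (hrow : ∀ i ∈ Rc f r, (∑ j ∈ Cr f r, (if (i, j) ∈ X then (1 : ZMod 2) else 0)) =
      ∑ j ∈ Cr f r, (if (i, j) ∈ Y then (1 : ZMod 2) else 0))
    (hcol : ∀ j ∈ Cr f r, (∑ i ∈ Rc f r, (if (i, j) ∈ X then (1 : ZMod 2) else 0)) =
      ∑ i ∈ Rc f r, (if (i, j) ∈ Y then (1 : ZMod 2) else 0)) :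
    ((((↑SA : Set ℤ), ((↑SB : Set ℤ), ((↑(X.image toSite) : Set (Site 2)),
      ((∅ : Set (Site 2)), (∅ : Set (Site 2)))))) : Bits) ∈ blockEvent f r η) ↔
    ((((↑SA : Set ℤ), ((↑SB : Set ℤ), ((↑(Y.image toSite) : Set (Site 2)),
      ((∅ : Set (Site 2)), (∅ : Set (Site 2)))))) : Bits) ∈ blockEvent f r η) := by
  simp only [blockEvent, Set.mem_setOf_eq]
  refine forall₂_congr fun v hv => ?_
  suffices h : blockZ (f 0 - r) (f 1 - r) ↑SA ↑SB (↑(X.image toSite)) v =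
      blockZ (f 0 - r) (f 1 - r) ↑SA ↑SB (↑(Y.image toSite)) v by rw [h]
  unfold blockZ
  rw [boxZ_image, boxZ_image]
  congr 1
  obtain ⟨⟨h1, h2, h3, h4⟩, hcase⟩ := hv
  rcases hcase with h0 | h0 | h0 | h0
  · rw [h0, Finset.Ico_self, Finset.sum_empty, Finset.sum_empty]
  · rw [h0, show Finset.Ico (f 0 - ↑r) (f 0 + 1 + ↑r) = Rc f r from rfl, Finset.sum_comm,
      Finset.sum_comm (s := Rc f r)]
    refine Finset.sum_congr rfl fun j hj => hcol j ?_
    unfold Cr; rw [Finset.mem_Ico] at hj ⊢; omega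
  · rw [h0, Finset.Ico_self]
    simp
  · rw [h0, show Finset.Ico (f 1 - ↑r) (f 1 + 1 + ↑r) = Cr f r from rfl]
    refine Finset.sum_congr rfl fun i hi => hrow i ?_
    unfold Rc; rw [Finset.mem_Ico] at hi ⊢; omega

/-- The shear of the cylinder expansion, without a syndrome-side event. [folklore] -/
theorem tripleSum_shear' (p : ℝ) (f : Site 2) (r : ℕ) (η : Site 2 → Prop) :
    tripleSum p (KAw f r) (KBw f r) (KDw f r) (ringCylinder f r η) =
      tripleSum p (KAw f r) (KBw f r) (KDw f r) (blockEvent f r η) := by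
  have h := tripleSum_shear p f r η (fun _ => True)
  simpa only [Set.setOf_true, Set.univ_inter] using h

end SyndromeBias

open SyndromeBias Finset in
/-- Registered stub `stub_SyndromeBias` of crux stmt-CriticalPhenomena-10964 (line `symmetric-seed-second-order`):
under the corner-line gauge with syndrome density `p ∈ (0,1)`, for every radius `r ≥ 1`, face `f` and ring colouring
`η`, `|P[κ_f = 1, Cyl] − p·P[Cyl]| ≤ C(p) |1 − 2p|^{2r} P[Cyl]` (cylinder formula + shear to the block gauge + the
character expansion over the row/column parity code of the `(2r+1)²` inner syndromes). [folklore] -/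
theorem stub_SyndromeBias :
    ∀ p : ℝ, 0 < p → p < 1 → ∃ C : ℝ, SyndromeBiasAt p C := by
  intro p hp0 hp1
  obtain ⟨K, hK, hsat⟩ := sat_bias hp0 hp1
  refine ⟨K, ?_⟩
  intro r hr f η
  -- Step 1: measures as triple sums over the inner window
  have h1 : (gaugeMeasure p).real ({ω | f ∈ ω.2.2.1} ∩ ringCylinder f r η) =
      tripleSum p (KAw f r) (KBw f r) (InD f r) ({ω | f ∈ ω.2.2.1} ∩ blockEvent f r η) := by
    rw [gauge_real_eq_tripleSum p _ _ _ _ ((DetBy.inter (detBy_syndrome f r) (detBy_ringCylinder f r η))),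
      tripleSum_shear p f r η (fun D => f ∈ D),
      ← gauge_real_eq_tripleSum p _ _ _ _ ((DetBy.inter (detBy_syndrome f r) (detBy_blockEvent f r η))),
      gauge_real_eq_tripleSum p _ _ _ _ ((DetBy.inter (detBy_syndrome' f r) (detBy_blockEvent' f r η)))]
  have h2 : (gaugeMeasure p).real (ringCylinder f r η) =
      tripleSum p (KAw f r) (KBw f r) (InD f r) (blockEvent f r η) := by
    rw [gauge_real_eq_tripleSum p _ _ _ _ (detBy_ringCylinder f r η), tripleSum_shear',
      ← gauge_real_eq_tripleSum p _ _ _ _ (detBy_blockEvent f r η),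
      gauge_real_eq_tripleSum p _ _ _ _ (detBy_blockEvent' f r η)]
  rw [h1, h2]
  -- Step 2: the finite claim
  have hRc : #(Rc f r) = 2 * r + 1 := card_Rc f r
  have hCc : #(Cr f r) = 2 * r + 1 := card_Cr f r
  have hfIn : (f 0, f 1) ∈ Rc f r ×ˢ Cr f r := fpair_mem_In f r
  have hq : qOf p = p := qOf_eq hp0.le hp1.le
  set c : ℝ := (1 / 2 : ℝ) ^ #(KAw f r) * (1 / 2 : ℝ) ^ #(KBw f r) with hc
  have hc0 : 0 ≤ c := by positivity
  have hInD : InD f r = (Rc f r ×ˢ Cr f r).image toSite := rfl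
  have hfS : ∀ S : Finset (ℤ × ℤ), f ∈ (↑(S.image toSite) : Set (Site 2)) ↔ (f 0, f 1) ∈ S := by
    intro S
    have e : f = toSite (f 0, f 1) := (toSite_pair f).symm
    constructor
    · intro h
      rw [Finset.mem_coe, e] at h
      exact toSite.injective.mem_finset_image.1 h
    · intro h
      rw [Finset.mem_coe, e]
      exact toSite.injective.mem_finset_image.2 h
  -- T2
  have hT2 : tripleSum p (KAw f r) (KBw f r) (InD f r) (blockEvent f r η) =
      ∑ SA ∈ (KAw f r).powerset, ∑ SB ∈ (KBw f r).powerset,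
        c * ∑ S ∈ (Rc f r ×ˢ Cr f r).powerset.filter (fun S =>
          (((↑SA : Set ℤ), ((↑SB : Set ℤ), ((↑(S.image toSite) : Set (Site 2)),
            ((∅ : Set (Site 2)), (∅ : Set (Site 2)))))) : Bits) ∈ blockEvent f r η),
          wt p (Rc f r ×ˢ Cr f r) S := by
    unfold tripleSum
    refine Finset.sum_congr rfl fun SA _ => Finset.sum_congr rfl fun SB _ => ?_
    rw [hInD, sum_powerset_image toSite.injective, Finset.sum_filter, Finset.mul_sum]
    refine Finset.sum_congr rfl fun S _ => ?_
    rw [Finset.card_image_of_injective _ toSite.injective,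
      Finset.card_image_of_injective _ toSite.injective, hq]
    unfold wt
    split_ifs <;> ring
  -- T1
  have hT1 : tripleSum p (KAw f r) (KBw f r) (InD f r) ({ω | f ∈ ω.2.2.1} ∩ blockEvent f r η) =
      ∑ SA ∈ (KAw f r).powerset, ∑ SB ∈ (KBw f r).powerset,
        c * ∑ S ∈ (Rc f r ×ˢ Cr f r).powerset.filter (fun S =>
          (((↑SA : Set ℤ), ((↑SB : Set ℤ), ((↑(S.image toSite) : Set (Site 2)),
            ((∅ : Set (Site 2)), (∅ : Set (Site 2)))))) : Bits) ∈ blockEvent f r η),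
          wt p (Rc f r ×ˢ Cr f r) S * (if (f 0, f 1) ∈ S then 1 else 0) := by
    unfold tripleSum
    refine Finset.sum_congr rfl fun SA _ => Finset.sum_congr rfl fun SB _ => ?_
    rw [hInD, sum_powerset_image toSite.injective, Finset.sum_filter, Finset.mul_sum]
    refine Finset.sum_congr rfl fun S _ => ?_
    rw [Finset.card_image_of_injective _ toSite.injective,
      Finset.card_image_of_injective _ toSite.injective, hq]
    have hmem : ((((↑SA : Set ℤ), ((↑SB : Set ℤ), ((↑(S.image toSite) : Set (Site 2)),
        ((∅ : Set (Site 2)), (∅ : Set (Site 2)))))) : Bits) ∈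
          {ω : Bits | f ∈ ω.2.2.1} ∩ blockEvent f r η) ↔
        ((f 0, f 1) ∈ S ∧ (((↑SA : Set ℤ), ((↑SB : Set ℤ), ((↑(S.image toSite) : Set (Site 2)),
          ((∅ : Set (Site 2)), (∅ : Set (Site 2)))))) : Bits) ∈ blockEvent f r η) := by
      rw [Set.mem_inter_iff, Set.mem_setOf_eq, hfS]
    rw [ite_congr_prop (d₂ := Classical.propDecidable _) hmem]
    unfold wt
    by_cases hA : (f 0, f 1) ∈ S <;>
      by_cases hB : (((↑SA : Set ℤ), ((↑SB : Set ℤ), ((↑(S.image toSite) : Set (Site 2)),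
          ((∅ : Set (Site 2)), (∅ : Set (Site 2)))))) : Bits) ∈ blockEvent f r η
    · rw [if_pos ⟨hA, hB⟩, if_pos hB, if_pos hA]; ring
    · rw [if_neg (fun h => hB h.2), if_neg hB]; ring
    · rw [if_neg (fun h => hA h.1), if_pos hB, if_neg hA]; ring
    · rw [if_neg (fun h => hB h.2), if_neg hB]; ring
  rw [hT1, hT2]
  refine abs_bias_sum_le _ _ _ _ c p _ hc0 fun SA _ SB _ => ?_
  -- the section event
  have hsec := hsat r hr (Rc f r) (Cr f r) hRc hCc (f 0, f 1) hfIn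
    (fun S => (((↑SA : Set ℤ), ((↑SB : Set ℤ), ((↑(S.image toSite) : Set (Site 2)),
      ((∅ : Set (Site 2)), (∅ : Set (Site 2)))))) : Bits) ∈ blockEvent f r η)
    (blockEvent_saturated f r η SA SB)
  refine le_of_eq_of_le ?_ hsec
  rw [Finset.mul_sum, ← Finset.sum_sub_distrib]
  congr 1
  exact Finset.sum_congr rfl fun S _ => by ring

end Summit.CriticalPhenomena.CardyFormulaZ2.Theorems.CornerLineDescent.SymmetricSeed
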